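import Summits.BirchSwinnertonDyer.BirchSwinnertonDyer.Theorems.EisensteinDepletionAtTwoStarStabCoeff
import HarnessLib

/-!
# Route `EisensteinDepletionAtTwo`, crux E1M `DepletedLambdaLawAtTwoMod` (item stmt-BirchSwinnertonDyer-20341),
# line `star`, Eisenstein half (★-EisNorm) — §B′: the boundary coefficient `c_β = ∑_{t ∣ N} c_t/t` has `‖c_β‖₂ ≤ 2⁻⁴`

Cell `bsd-rank2`, seat `bsd-rank2-eng-2` GEN 8. THEOREMS ONLY — no definition, no named fact, no `sorry`. HONEST FRAMING:
elementary `2`-adic bookkeeping (sequel of `…StarStabCoeff.lean`): `c_β = ∑_{t ∣ N} c_t/t = ∏_ℓ L_ℓ(1/ℓ)` for the stabilisation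
coefficients of `Theorems/EisensteinDepletionAtTwoStarDefs.lean`; the local factors `(ℓ−1)/ℓ` (`β_ℓ = ℓ`), `(ℓ²−1)/ℓ²` (`β_ℓ = 1`),
`(ℓ−1)²(ℓ+1)/ℓ³` (`ℓ² ∥ N`) have `2`-adic norms `≤ 2⁻¹, 2⁻³, 2⁻⁴` for odd `ℓ`, and admissibility supplies a depleted prime or a
`β_ℓ = ℓ` prime AND a `β_ℓ = 1` prime, whence **`norm_cBeta_le : ‖c_β‖₂ ≤ 2⁻⁴`**. This is why the Bézout boundary term
`c_β·N·y/2^m` of the Eisenstein cusp values dies modulo `2` after Stevens smoothing in the `8`-normalisation (evidence #39 on the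
item, finite-level form (★-EisFin)). Nothing here reads an analytic rank; (★)/E1M are NOT proved; BSD is not proved by any of this
(PARTITION D-0054: none — r_an ≥ 2 axis S0, door T-r3₂).

References: G. Stevens, *Arithmetic on Modular Curves*, Progress in Math. 20 (1982), §2.4–2.5 [Stevens1982].
-/

set_option linter.dupNamespace false
set_option autoImplicit false

noncomputable section

open scoped Classical

namespace Summit.BirchSwinnertonDyer.BirchSwinnertonDyer.Theorems.DepletionAtTwo

section Boundary

variable {N : ℕ} {β : ℕ → ℕ}

/-! ### The boundary coefficient `c_β = ∑_t c_t / t` has `‖c_β‖₂ ≤ 2⁻⁴` -/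

/-- `c_β = ∑_{t ∣ N} c_t/t` as an Euler product `∏_ℓ ∑_j c_ℓ(j) ℓ^{-j}`. [cite: Stevens1982, §2.4–2.5 (PDF pp. 35–38)] -/
theorem sum_divisors_stabCoeff_div_eq_prod (hN : N ≠ 0) :
    ∑ t ∈ N.divisors, stabCoeff N β t / t =
      ∏ ℓ ∈ N.primeFactors, ∑ j ∈ Finset.range (N.factorization ℓ + 1),
        localStabCoeff N β ℓ j * ((ℓ : ℚ)⁻¹) ^ j := by
  have h := sum_divisors_stabCoeff_mul N β (R := ℚ) (fun t ↦ ((t : ℚ))⁻¹) (by simp)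
    (fun m n _ _ _ ↦ by rw [Nat.cast_mul, mul_inv]) hN
  simp only [Algebra.algebraMap_self, RingHom.id_apply] at h
  simp only [div_eq_mul_inv]
  rw [h]
  refine Finset.prod_congr rfl fun ℓ hℓ ↦ Finset.sum_congr rfl fun j _ ↦ ?_
  rw [stabCoeff_prime_pow N β hℓ, Nat.cast_pow, inv_pow]

/-- The local factor of `c_β` at `ℓ ∥ N` with `β_ℓ = ℓ`: `(ℓ − 1)/ℓ`. [cite: Stevens1982, §2.4 (PDF pp. 35–37)] -/
theorem cBetaLocal_of_eq_one_of_eq {ℓ : ℕ} (hℓ : ℓ ∈ N.primeFactors) (h1 : N.factorization ℓ = 1) (hb : β ℓ = ℓ) :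
    ∑ j ∈ Finset.range (N.factorization ℓ + 1), localStabCoeff N β ℓ j * ((ℓ : ℚ)⁻¹) ^ j =
      ((ℓ : ℚ) - 1) / ℓ := by
  have hℓ0 : (ℓ : ℚ) ≠ 0 := by exact_mod_cast (Nat.prime_of_mem_primeFactors hℓ).ne_zero
  have := sum_range_localStabCoeff_of_eq_one N β (R := ℚ) h1 ((ℓ : ℚ)⁻¹)
  simp only [Algebra.algebraMap_self, RingHom.id_apply] at this
  rw [this, hb]
  field_simp

/-- The local factor of `c_β` at `ℓ ∥ N` with `β_ℓ = 1`: `(ℓ² − 1)/ℓ²`. [cite: Stevens1982, §2.4 (PDF pp. 35–37)] -/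
theorem cBetaLocal_of_eq_one_of_one {ℓ : ℕ} (hℓ : ℓ ∈ N.primeFactors) (h1 : N.factorization ℓ = 1) (hb : β ℓ = 1) :
    ∑ j ∈ Finset.range (N.factorization ℓ + 1), localStabCoeff N β ℓ j * ((ℓ : ℚ)⁻¹) ^ j =
      ((ℓ : ℚ) ^ 2 - 1) / (ℓ : ℚ) ^ 2 := by
  have hℓ0 : (ℓ : ℚ) ≠ 0 := by exact_mod_cast (Nat.prime_of_mem_primeFactors hℓ).ne_zero
  have := sum_range_localStabCoeff_of_eq_one N β (R := ℚ) h1 ((ℓ : ℚ)⁻¹)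
  simp only [Algebra.algebraMap_self, RingHom.id_apply] at this
  rw [this, hb, Nat.cast_one]
  field_simp

/-- The local factor of `c_β` at a fully depleted prime `ℓ² ∥ N`: `(ℓ − 1)²(ℓ + 1)/ℓ³`.
[cite: Stevens1982, §2.4 (PDF pp. 35–37)] -/
theorem cBetaLocal_of_eq_two {ℓ : ℕ} (hℓ : ℓ ∈ N.primeFactors) (h2 : N.factorization ℓ = 2) :
    ∑ j ∈ Finset.range (N.factorization ℓ + 1), localStabCoeff N β ℓ j * ((ℓ : ℚ)⁻¹) ^ j =
      ((ℓ : ℚ) - 1) ^ 2 * ((ℓ : ℚ) + 1) / (ℓ : ℚ) ^ 3 := by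
  have hℓ0 : (ℓ : ℚ) ≠ 0 := by exact_mod_cast (Nat.prime_of_mem_primeFactors hℓ).ne_zero
  have := sum_range_localStabCoeff_of_eq_two N β (R := ℚ) h2 ((ℓ : ℚ)⁻¹)
  simp only [Algebra.algebraMap_self, RingHom.id_apply] at this
  rw [this]
  field_simp
  ring

/-- `‖(z : ℚ₂)/u‖ ≤ 2^{-n}` for an integer `z` divisible by `2^n` and a `2`-adic unit `u`. [folklore] -/
theorem norm_intCast_div_le_of_dvd {z : ℤ} {n : ℕ} (hz : (2 ^ n : ℤ) ∣ z) {u : ℚ_[2]} (hu : ‖u‖ = 1) :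
    ‖(z : ℚ_[2]) / u‖ ≤ (2 : ℝ) ^ (-(n : ℤ)) := by
  rw [norm_div, hu, div_one]
  exact_mod_cast (Padic.norm_int_le_pow_iff_dvd z n).mpr hz

/-- For an odd prime factor `ℓ` of `N` (odd `N`): `2 ∣ ℓ − 1`, `8 ∣ ℓ² − 1`, `16 ∣ (ℓ − 1)²(ℓ + 1)`. [folklore] -/
theorem dvd_of_odd_prime {ℓ : ℕ} (hℓ : Odd ℓ) :
    (2 ^ 1 : ℤ) ∣ (ℓ : ℤ) - 1 ∧ (2 ^ 3 : ℤ) ∣ (ℓ : ℤ) ^ 2 - 1 ∧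
      (2 ^ 4 : ℤ) ∣ ((ℓ : ℤ) - 1) ^ 2 * ((ℓ : ℤ) + 1) := by
  obtain ⟨k, rfl⟩ := hℓ
  obtain ⟨m, hm⟩ := Nat.even_mul_succ_self k
  push_cast
  have hk : (k : ℤ) * (k + 1) = m + m := by exact_mod_cast hm
  refine ⟨⟨k, by ring⟩, ⟨m, ?_⟩, ⟨k * m, ?_⟩⟩
  · linear_combination (4 : ℤ) * hk
  · linear_combination (8 * k : ℤ) * hk

/-- A prime factor of an odd number is odd. [folklore] -/
theorem odd_of_mem_primeFactors_odd (hodd : Odd N) {ℓ : ℕ} (hℓ : ℓ ∈ N.primeFactors) : Odd ℓ :=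
  hodd.of_dvd_nat (Nat.dvd_of_mem_primeFactors hℓ)

/-- **Every local factor of `c_β` has norm `≤ 1/2`, the `β_ℓ = 1` one `≤ 1/8`, the depleted one `≤ 1/16`.**
[cite: Stevens1982, §2.4 (PDF pp. 35–37)] -/
theorem norm_cBetaLocal_le (hodd : Odd N) (hadm : IsAdmissibleStabData N β) {ℓ : ℕ} (hℓ : ℓ ∈ N.primeFactors) :
    ‖((∑ j ∈ Finset.range (N.factorization ℓ + 1), localStabCoeff N β ℓ j * ((ℓ : ℚ)⁻¹) ^ j : ℚ) : ℚ_[2])‖ ≤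
        (2 : ℝ) ^ (-(1 : ℤ)) ∧
      (N.factorization ℓ = 1 → β ℓ = 1 →
        ‖((∑ j ∈ Finset.range (N.factorization ℓ + 1), localStabCoeff N β ℓ j * ((ℓ : ℚ)⁻¹) ^ j : ℚ) : ℚ_[2])‖ ≤
          (2 : ℝ) ^ (-(3 : ℤ))) ∧
      (N.factorization ℓ = 2 →
        ‖((∑ j ∈ Finset.range (N.factorization ℓ + 1), localStabCoeff N β ℓ j * ((ℓ : ℚ)⁻¹) ^ j : ℚ) : ℚ_[2])‖ ≤
          (2 : ℝ) ^ (-(4 : ℤ))) := by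
  have hℓ1 := norm_natCast_eq_one_of_mem_primeFactors_odd hodd hℓ
  obtain ⟨d1, d3, d4⟩ := dvd_of_odd_prime (odd_of_mem_primeFactors_odd hodd hℓ)
  have hpow : ∀ j : ℕ, ‖((ℓ : ℚ_[2])) ^ j‖ = 1 := fun j ↦ by rw [norm_pow, hℓ1, one_pow]
  -- the three cases
  have case2 : N.factorization ℓ = 2 →
      ‖((∑ j ∈ Finset.range (N.factorization ℓ + 1), localStabCoeff N β ℓ j * ((ℓ : ℚ)⁻¹) ^ j : ℚ) : ℚ_[2])‖ ≤
        (2 : ℝ) ^ (-(4 : ℤ)) := fun h2 ↦ by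
    rw [cBetaLocal_of_eq_two hℓ h2]
    push_cast
    have := norm_intCast_div_le_of_dvd d4 (hpow 3)
    push_cast at this
    exact this
  have case11 : N.factorization ℓ = 1 → β ℓ = 1 →
      ‖((∑ j ∈ Finset.range (N.factorization ℓ + 1), localStabCoeff N β ℓ j * ((ℓ : ℚ)⁻¹) ^ j : ℚ) : ℚ_[2])‖ ≤
        (2 : ℝ) ^ (-(3 : ℤ)) := fun h1 hb ↦ by
    rw [cBetaLocal_of_eq_one_of_one hℓ h1 hb]
    push_cast
    have := norm_intCast_div_le_of_dvd d3 (hpow 2)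
    push_cast at this
    exact this
  have case1ℓ : N.factorization ℓ = 1 → β ℓ = ℓ →
      ‖((∑ j ∈ Finset.range (N.factorization ℓ + 1), localStabCoeff N β ℓ j * ((ℓ : ℚ)⁻¹) ^ j : ℚ) : ℚ_[2])‖ ≤
        (2 : ℝ) ^ (-(1 : ℤ)) := fun h1 hb ↦ by
    rw [cBetaLocal_of_eq_one_of_eq hℓ h1 hb]
    push_cast
    have := norm_intCast_div_le_of_dvd d1 (u := (ℓ : ℚ_[2])) (by rw [hℓ1])
    push_cast at this
    exact this
  refine ⟨?_, case11, case2⟩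
  rcases factorization_eq_one_or_two_of_admissible hadm hℓ with h1 | h2
  · rcases hadm.2.1 ℓ hℓ h1 with hb | hb
    · exact (case11 h1 hb).trans (by norm_num)
    · exact case1ℓ h1 hb
  · exact (case2 h2).trans (by norm_num)

/-- **`‖c_β‖₂ ≤ 2⁻⁴` for admissible data at odd level** (one fully depleted prime gives `2⁴`; otherwise the
`β_ℓ = ℓ` prime gives `2` and the `β_ℓ = 1` prime gives `2³`). [cite: Stevens1982, §2.4–2.5 (PDF pp. 35–38)] -/
theorem norm_cBeta_le (hN : N ≠ 0) (hodd : Odd N) (hadm : IsAdmissibleStabData N β) :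
    ‖((∑ t ∈ N.divisors, stabCoeff N β t / t : ℚ) : ℚ_[2])‖ ≤ (2 : ℝ) ^ (-(4 : ℤ)) := by
  rw [sum_divisors_stabCoeff_div_eq_prod hN]
  push_cast
  rw [norm_prod]
  -- abbreviate the local norms
  set F : ℕ → ℝ := fun ℓ ↦
    ‖∑ j ∈ Finset.range (N.factorization ℓ + 1), ((localStabCoeff N β ℓ j : ℚ) : ℚ_[2]) * (((ℓ : ℚ_[2]))⁻¹) ^ j‖
    with hF
  have hF' : ∀ ℓ ∈ N.primeFactors, F ℓ =
      ‖((∑ j ∈ Finset.range (N.factorization ℓ + 1), localStabCoeff N β ℓ j * ((ℓ : ℚ)⁻¹) ^ j : ℚ) : ℚ_[2])‖ := by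
    intro ℓ _; simp only [hF]; push_cast; rfl
  have hle1 : ∀ ℓ ∈ N.primeFactors, F ℓ ≤ 1 := fun ℓ hℓ ↦ by
    rw [hF' ℓ hℓ]; exact (norm_cBetaLocal_le hodd hadm hℓ).1.trans (by norm_num)
  have hnn : ∀ ℓ ∈ N.primeFactors, 0 ≤ F ℓ := fun ℓ _ ↦ norm_nonneg _
  show ∏ ℓ ∈ N.primeFactors, F ℓ ≤ 2 ^ (-(4 : ℤ))
  rcases hadm.2.2 with ⟨ℓ₀, hℓ₀, h2⟩ | ⟨⟨ℓ₁, hℓ₁, hb₁⟩, ⟨ℓ₂, hℓ₂, hb₂⟩⟩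
  · rw [← Finset.mul_prod_erase _ _ hℓ₀]
    calc F ℓ₀ * ∏ ℓ ∈ N.primeFactors.erase ℓ₀, F ℓ ≤ 2 ^ (-(4 : ℤ)) * 1 := by
          refine mul_le_mul ?_ (Finset.prod_le_one (fun ℓ hℓ ↦ hnn ℓ (Finset.mem_of_mem_erase hℓ))
            fun ℓ hℓ ↦ hle1 ℓ (Finset.mem_of_mem_erase hℓ)) (Finset.prod_nonneg fun ℓ hℓ ↦
            hnn ℓ (Finset.mem_of_mem_erase hℓ)) (by positivity)
          rw [hF' ℓ₀ hℓ₀]; exact (norm_cBetaLocal_le hodd hadm hℓ₀).2.2 h2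
      _ = 2 ^ (-(4 : ℤ)) := mul_one _
  · -- `ℓ₁ ≠ ℓ₂`
    have hne : ℓ₂ ≠ ℓ₁ := by
      rintro rfl
      rw [hb₂] at hb₁
      exact (Nat.prime_of_mem_primeFactors hℓ₁).one_lt.ne hb₁
    have hℓ₂' : ℓ₂ ∈ N.primeFactors.erase ℓ₁ := Finset.mem_erase.mpr ⟨hne, hℓ₂⟩
    -- bounds for the two special factors
    have b₁ : F ℓ₁ ≤ 2 ^ (-(1 : ℤ)) := by rw [hF' ℓ₁ hℓ₁]; exact (norm_cBetaLocal_le hodd hadm hℓ₁).1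
    have b₂ : F ℓ₂ ≤ 2 ^ (-(3 : ℤ)) := by
      rw [hF' ℓ₂ hℓ₂]
      rcases factorization_eq_one_or_two_of_admissible hadm hℓ₂ with h1 | h2
      · exact (norm_cBetaLocal_le hodd hadm hℓ₂).2.1 h1 hb₂
      · exact ((norm_cBetaLocal_le hodd hadm hℓ₂).2.2 h2).trans (by norm_num)
    rw [← Finset.mul_prod_erase _ _ hℓ₁, ← Finset.mul_prod_erase _ _ hℓ₂']
    have hrest : ∏ ℓ ∈ (N.primeFactors.erase ℓ₁).erase ℓ₂, F ℓ ≤ 1 :=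
      Finset.prod_le_one (fun ℓ hℓ ↦ hnn ℓ (Finset.mem_of_mem_erase (Finset.mem_of_mem_erase hℓ)))
        fun ℓ hℓ ↦ hle1 ℓ (Finset.mem_of_mem_erase (Finset.mem_of_mem_erase hℓ))
    have hrest0 : 0 ≤ ∏ ℓ ∈ (N.primeFactors.erase ℓ₁).erase ℓ₂, F ℓ :=
      Finset.prod_nonneg fun ℓ hℓ ↦ hnn ℓ (Finset.mem_of_mem_erase (Finset.mem_of_mem_erase hℓ))
    calc F ℓ₁ * (F ℓ₂ * ∏ ℓ ∈ (N.primeFactors.erase ℓ₁).erase ℓ₂, F ℓ)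
        ≤ 2 ^ (-(1 : ℤ)) * (2 ^ (-(3 : ℤ)) * 1) := by
          refine mul_le_mul b₁ (mul_le_mul b₂ hrest hrest0 (by positivity)) (mul_nonneg (hnn ℓ₂ hℓ₂) hrest0)
            (by positivity)
      _ = 2 ^ (-(4 : ℤ)) := by norm_num

end Boundary

end Summit.BirchSwinnertonDyer.BirchSwinnertonDyer.Theorems.DepletionAtTwo

end
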